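import Summits.AtomisticToContinuum.HydrodynamicLimit.Theses.OneFlightGossipEngine
import Summits.AtomisticToContinuum.HydrodynamicLimit.Theorems.OneFlightGossipEngineKineticCurrentsWindowLDUniformLedgerAssemblyDuality
import Summits.AtomisticToContinuum.HydrodynamicLimit.Theorems.OneFlightGossipEngineKineticCurrentsWindowLDUniformLedgerAssemblyStatics

/-!
# Ledger assembly for the crux `KineticCurrentsWindowLDUniform` (stmt-AtomisticToContinuum-14662),
# line `gossip-forecast-ledger`, stub `stub_ledgerAssembly` (S5) — helper file C: the ledger at one sign

Helper file C of the registered stub `stub_ledgerAssembly` of the line skeleton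
`Cruxes/KineticCurrentsWindowLDUniform/Lines/gossip_forecast_ledger.lean` (A `…LedgerAssemblyDuality`,
B `…LedgerAssemblyStatics`, D `…LedgerAssembly`).  `stub_ledgerAssembly_core`: given the abstract
entropy ledger (S2 of the line, as a hypothesis), static exponential moments `e^{c|X_T|} ∈ L¹(λ_N)` for
`c ≤ c₀` (file B), and — for all `τ, δ > 0`, all large `N`, every half `S` — a monotone Borel
filtration `ℱ` revealing `X_S` (S1 of the line) carrying the forecast moment K2 (S3) and the QV proxy
K3 (S4), every `0 < β` with `2β ≤ c₀` and `2β(1/κ + 1/α + α/(2 lam)) ≤ 1` and every `ε > 0` admit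
`τ > 0`, `N₀` with `∫⁻ e^{β X_N} dλ_N ≤ e^{ε(N+1)}` for `N ≥ N₀`, `X_N` the full window functional of `F`.

Proof: `δ := ε/(4βD)`, `τ := 4βDC⁺/ε + 1`, `D = 1/κ + α/(2 lam)`, `C⁺ = max (max C₂ C₃) 0`; for
`N ≥ N₀`: `Q := λ.tilted (βX)`, `log ∫ e^{βX} dλ = β E_Q X − KL(Q‖λ)` (file A); split
`X = X_{S₁} + X_{S₂}` over `S₁ = Iio ⌊(N+1)/2⌋`, `S₂ = S₁ᶜ` (`2|S| ≤ N+2`); on each half S2 with the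
given filtration and proxy `V` — `Q`-integrability of `X_S`, `f₀ = λ[X_S|ℱ 0]`, `ΣV` from exponential
moments (file A, conditional Jensen for `f₀`) — then the entropy inequality on `f₀` (`c = κ`) and on `ΣV`
(`c = lam`): `E_Q X_S ≤ (KL + B₂)/κ + KL/α + (α/2)(KL + B₃)/lam`; adding the halves the `KL` terms
cancel against `−KL` and `log ∫ e^{βX} dλ ≤ 2βD(C⁺/τ + δ)(N+1) ≤ ε(N+1)`.
-/

noncomputable section

open MeasureTheory Set Filter InformationTheory
open scoped ENNReal Topology Classical ProbabilityTheory

namespace Summit.AtomisticToContinuum.HydrodynamicLimit.Theorems.KineticCurrentsWindowLDUniformGossip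

open Literature.Analysis.FluidPDE (HardSphereFlow Config localMaxwellian)
open Literature.MathematicalPhysics.KineticTheory (T3 V3 hsDiameter localGibbsLaw
  isProbabilityMeasure_localGibbsLaw localGibbsLaw_eq)
open LedgerAssembly

/-- **Registered helper stub `stub_ledgerAssembly_core` — the ledger for `0 < β ≤ β₀`.** Given the
abstract entropy ledger (S2 of the line, as a hypothesis), static exponential moments of the group window
functionals (`e^{c|X_T|} ∈ L¹(λ_N)` for `c ≤ c₀`, file B), and for every `τ, δ > 0`, all large `N` and
every half `S` (`2|S| ≤ N+2`) a filtration `ℱ` (monotone, Borel) revealing `X_S`, with the forecast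
moment `∫⁻ e^{κ λ[X_S|ℱ 0]} dλ ≤ e^{(C₂/τ+δ)(N+1)}` (K2) and a predictable proxy `V` of the forecast
increments with `∫⁻ e^{lam ΣV} dλ ≤ e^{(C₃/τ+δ)(N+1)}` (K3), the full window functional of `F` obeys
`∫⁻ e^{βX_N} dλ_N ≤ e^{ε(N+1)}` for `N` large, for every `0 < β` with `2β ≤ c₀` and
`2β(1/κ + 1/α + α/(2 lam)) ≤ 1`. [folklore] -/
theorem stub_ledgerAssembly_core :
    (∀ (Ω : Type) [mΩ : MeasurableSpace Ω] (P Q : Measure Ω) [IsProbabilityMeasure P] [IsProbabilityMeasure Q],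
          Q ≪ P → klDiv Q P ≠ ∞ →
          ∀ (ℱ : ℕ → MeasurableSpace Ω), Monotone ℱ → (∀ n, ℱ n ≤ mΩ) →
          ∀ (X : Ω → ℝ), Integrable X P → Integrable X Q → AEStronglyMeasurable[⨆ n, ℱ n] X P →
          Integrable (P[X|ℱ 0]) Q →
          ∀ α : ℝ, 0 < α → ∀ (V : ℕ → Ω → ℝ), (∀ k ω, 0 ≤ V k ω) → (∀ k, Measurable[ℱ k] (V k)) →
          (∀ᵐ ω ∂P, Summable (fun k => V k ω)) → Integrable (fun ω => ∑' k, V k ω) Q →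
          (∀ (k : ℕ) (s : Set Ω), MeasurableSet[ℱ k] s →
            ∫⁻ ω in s, ENNReal.ofReal (Real.exp (α * ((P[X|ℱ (k + 1)]) ω - (P[X|ℱ k]) ω) - α ^ 2 * V k ω / 2)) ∂P
              ≤ P s) →
          ∫ ω, X ω ∂Q - ∫ ω, (P[X|ℱ 0]) ω ∂Q ≤ (klDiv Q P).toReal / α + α / 2 * ∫ ω, (∑' k, V k ω) ∂Q) →
    ∀ (a θ₀ : T3 → ℝ) (u₀ : T3 → V3), Continuous a → Continuous θ₀ → Continuous u₀ →
      (∀ x, 0 < a x) → (∀ x, 0 < θ₀ x) → ∀ σ : ℝ, 0 < σ → σ ≤ 1 / 2 →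
    ∀ Φ : (N : ℕ) → HardSphereFlow (Literature.Analysis.FluidPDE.Torus.geometry (Fin 3)) (hsDiameter σ N) (N + 1),
    ∀ (F : T3 × V3 → ℝ), Continuous F → ∀ c₀ : ℝ, 0 < c₀ →
    (∀ c : ℝ, 0 ≤ c → c ≤ c₀ → ∀ (N : ℕ) (T : Finset (Fin (N + 1))) (w : ℝ), 0 < w →
      ∫⁻ z, ENNReal.ofReal (Real.exp (c * |∑ i ∈ T, w⁻¹ * ∫ r in (0 : ℝ)..w, F (((Φ N).flow r z) i)|))
        ∂(localGibbsLaw σ a u₀ θ₀ N (Φ N)) ≠ ∞) →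
    ∀ κ : ℝ, 0 < κ → ∀ α : ℝ, 0 < α → ∀ lam : ℝ, 0 < lam → ∀ C₂ C₃ : ℝ,
    (∀ τ : ℝ, 0 < τ → ∀ δ : ℝ, 0 < δ → ∃ N₀ : ℕ, ∀ N : ℕ, N₀ ≤ N →
      ∀ S : Finset (Fin (N + 1)), 2 * S.card ≤ N + 2 →
      ∃ ℱ : ℕ → MeasurableSpace (Config (N + 1) (Fin 3) T3), Monotone ℱ ∧
        (∀ n, ℱ n ≤ (inferInstance : MeasurableSpace (Config (N + 1) (Fin 3) T3))) ∧
        AEStronglyMeasurable[⨆ n, ℱ n] (fun z => ∑ i ∈ S, (τ * ((N : ℝ) + 1) ^ (-(1 / 3 : ℝ)))⁻¹ * ∫ r in (0 : ℝ)..(τ * ((N : ℝ) + 1) ^ (-(1 / 3 : ℝ))), F (((Φ N).flow r z) i)) (localGibbsLaw σ a u₀ θ₀ N (Φ N)) ∧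
        ∫⁻ z, ENNReal.ofReal (Real.exp (κ * ((localGibbsLaw σ a u₀ θ₀ N (Φ N))[fun z => ∑ i ∈ S, (τ * ((N : ℝ) + 1) ^ (-(1 / 3 : ℝ)))⁻¹ * ∫ r in (0 : ℝ)..(τ * ((N : ℝ) + 1) ^ (-(1 / 3 : ℝ))), F (((Φ N).flow r z) i)|ℱ 0]) z)) ∂(localGibbsLaw σ a u₀ θ₀ N (Φ N)) ≤
          ENNReal.ofReal (Real.exp ((C₂ / τ + δ) * ((N : ℝ) + 1))) ∧
        ∃ V : ℕ → Config (N + 1) (Fin 3) T3 → ℝ,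
          (∀ k z, 0 ≤ V k z) ∧ (∀ k, Measurable[ℱ k] (V k)) ∧ (∀ᵐ z ∂(localGibbsLaw σ a u₀ θ₀ N (Φ N)), Summable (fun k => V k z)) ∧
          (∀ (k : ℕ) (s : Set (Config (N + 1) (Fin 3) T3)), MeasurableSet[ℱ k] s →
            ∫⁻ z in s, ENNReal.ofReal (Real.exp (α * (((localGibbsLaw σ a u₀ θ₀ N (Φ N))[fun z => ∑ i ∈ S, (τ * ((N : ℝ) + 1) ^ (-(1 / 3 : ℝ)))⁻¹ * ∫ r in (0 : ℝ)..(τ * ((N : ℝ) + 1) ^ (-(1 / 3 : ℝ))), F (((Φ N).flow r z) i)|ℱ (k + 1)]) z - ((localGibbsLaw σ a u₀ θ₀ N (Φ N))[fun z => ∑ i ∈ S, (τ * ((N : ℝ) + 1) ^ (-(1 / 3 : ℝ)))⁻¹ * ∫ r in (0 : ℝ)..(τ * ((N : ℝ) + 1) ^ (-(1 / 3 : ℝ))), F (((Φ N).flow r z) i)|ℱ k]) z) - α ^ 2 * V k z / 2)) ∂(localGibbsLaw σ a u₀ θ₀ N (Φ N))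
              ≤ (localGibbsLaw σ a u₀ θ₀ N (Φ N)) s) ∧
          ∫⁻ z, ENNReal.ofReal (Real.exp (lam * ∑' k, V k z)) ∂(localGibbsLaw σ a u₀ θ₀ N (Φ N)) ≤
            ENNReal.ofReal (Real.exp ((C₃ / τ + δ) * ((N : ℝ) + 1)))) →
    ∀ β : ℝ, 0 < β → 2 * β ≤ c₀ → 2 * β * (1 / κ + 1 / α + α / (2 * lam)) ≤ 1 →
    ∀ ε : ℝ, 0 < ε → ∃ τ : ℝ, 0 < τ ∧ ∃ N₀ : ℕ, ∀ N : ℕ, N₀ ≤ N →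
      ∫⁻ z, ENNReal.ofReal (Real.exp (β * ∑ i : Fin (N + 1),
        (τ * ((N : ℝ) + 1) ^ (-(1 / 3 : ℝ)))⁻¹ *
          ∫ r in (0 : ℝ)..(τ * ((N : ℝ) + 1) ^ (-(1 / 3 : ℝ))), F (((Φ N).flow r z) i)))
        ∂(localGibbsLaw σ a u₀ θ₀ N (Φ N)) ≤ ENNReal.ofReal (Real.exp (ε * ((N : ℝ) + 1))) := by
  intro hS2 a θ₀ u₀ ha hθ hu ha0 hθ0 σ hσ hσ2 Φ F hFc c₀ hc₀ hstat κ hκ α hα lam hlam C₂ C₃ h34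
    β hβ hβc hβ1 ε hε
  /- constants and the choice of `δ`, `τ` -/
  set D : ℝ := 1 / κ + α / (2 * lam) with hDdef
  have hD0 : 0 < D := by positivity
  set Cp : ℝ := max (max C₂ C₃) 0 with hCpdef
  have hCp0 : 0 ≤ Cp := le_max_right _ _
  have hC₂le : C₂ ≤ Cp := (le_max_left _ _).trans (le_max_left _ _)
  have hC₃le : C₃ ≤ Cp := (le_max_right _ _).trans (le_max_left _ _)
  set δ : ℝ := ε / (4 * β * D) with hδdef
  have hδ0 : 0 < δ := by positivity
  set τ : ℝ := 4 * β * D * Cp / ε + 1 with hτdef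
  have hτ0 : 0 < τ := by positivity
  have hCpτ : Cp / τ ≤ ε / (4 * β * D) := by
    rw [div_le_div_iff₀ hτ0 (by positivity), hτdef]
    have h : ε * (4 * β * D * Cp / ε + 1) = 4 * β * D * Cp + ε := by field_simp
    rw [h]
    linarith [hε.le]
  have hbudget : 2 * β * D * (Cp / τ + δ) ≤ ε := by
    have h2 : 2 * β * D * δ = ε / 2 := by rw [hδdef]; field_simp; ring
    have h3 : 2 * β * D * (Cp / τ) ≤ 2 * β * D * (ε / (4 * β * D)) :=
      mul_le_mul_of_nonneg_left hCpτ (by positivity)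
    have h4 : 2 * β * D * (ε / (4 * β * D)) = ε / 2 := by field_simp; ring
    have h5 : 2 * β * D * (Cp / τ + δ) = 2 * β * D * (Cp / τ) + 2 * β * D * δ := by ring
    linarith
  obtain ⟨N₀, hN₀⟩ := h34 τ hτ0 δ hδ0
  refine ⟨τ, hτ0, N₀, fun N hN => ?_⟩
  /- fixed `N`: window, law, group functionals -/
  set w : ℝ := τ * ((N : ℝ) + 1) ^ (-(1 / 3 : ℝ)) with hwdef
  have hw : 0 < w := by positivity
  set P : Measure (Config (N + 1) (Fin 3) T3) := localGibbsLaw σ a u₀ θ₀ N (Φ N) with hPdef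
  haveI hPprob : IsProbabilityMeasure P :=
    isProbabilityMeasure_localGibbsLaw ha hθ hu ha0 hθ0 hσ2 N (Φ N)
  have hPac : P ≪ Literature.Analysis.FluidPDE.liouville (Literature.Analysis.FluidPDE.Torus.geometry (Fin 3))
      (N + 1) (hsDiameter σ N) := by
    rw [hPdef, Literature.MathematicalPhysics.KineticTheory.localGibbsLaw,
      Literature.Analysis.FluidPDE.particleLaw_eq]
    exact withDensity_absolutelyContinuous _ _
  have hPgood : P (Φ N).goodᶜ = 0 := hPac (Φ N).measure_compl_good
  set XT : Finset (Fin (N + 1)) → Config (N + 1) (Fin 3) T3 → ℝ :=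
    fun T z => ∑ i ∈ T, w⁻¹ * ∫ r in (0 : ℝ)..w, F (((Φ N).flow r z) i) with hXTdef
  have hXm : ∀ T, AEStronglyMeasurable (XT T) P := by
    intro T
    refine (Finset.aemeasurable_fun_sum T fun i _ => ?_).aestronglyMeasurable
    exact ((Φ N).aemeasurable_intervalIntegral_comp_flow_torus (f := fun z => F (z i))
      (hFc.measurable.comp (measurable_pi_apply i)) 0 w hPgood).const_mul _
  have hexpT : ∀ T, ∀ c : ℝ, 0 ≤ c → c ≤ c₀ → Integrable (fun z => Real.exp (c * |XT T z|)) P := by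
    intro T c hc0 hc1
    have hne := hstat c hc0 hc1 N T w hw
    have hm : AEStronglyMeasurable (fun z => Real.exp (c * |XT T z|)) P :=
      (by fun_prop : Continuous fun x : ℝ => Real.exp (c * |x|)).comp_aestronglyMeasurable (hXm T)
    exact (lintegral_ofReal_ne_top_iff_integrable hm (ae_of_all _ fun _ => (Real.exp_pos _).le)).1 hne
  have hintT : ∀ T, Integrable (XT T) P := by
    intro T
    refine ((hexpT T c₀ hc₀.le le_rfl).div_const c₀).mono' (hXm T) (ae_of_all _ fun z => ?_)
    rw [Real.norm_eq_abs, le_div_iff₀ hc₀]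
    nlinarith [Real.add_one_le_exp (c₀ * |XT T z|), abs_nonneg (XT T z)]
  have h2c : 2 * (c₀ / 2) = c₀ := by ring
  /- the full functional and the tilted law -/
  set X : Config (N + 1) (Fin 3) T3 → ℝ := XT Finset.univ with hXdef
  have hexp_of_le : ∀ c : ℝ, 0 ≤ c → c ≤ c₀ → Integrable (fun z => Real.exp (c * X z)) P := by
    intro c hc0 hc1
    refine (hexpT Finset.univ c hc0 hc1).mono'
      (Real.continuous_exp.comp_aestronglyMeasurable ((hXm _).const_mul c)) (ae_of_all _ fun z => ?_)
    rw [Real.norm_eq_abs, abs_of_pos (Real.exp_pos _)]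
    exact Real.exp_le_exp.2 (mul_le_mul_of_nonneg_left (le_abs_self _) hc0)
  have hexpβ : Integrable (fun z => Real.exp (β * X z)) P := hexp_of_le β hβ.le (by linarith)
  have hexp2β : Integrable (fun z => Real.exp (2 * (β * X z))) P := by
    have h := hexp_of_le (2 * β) (by positivity) hβc
    refine h.congr (ae_of_all _ fun z => ?_)
    simp only [mul_assoc]
  set Q : Measure (Config (N + 1) (Fin 3) T3) := P.tilted (fun z => β * X z) with hQdef
  haveI hQprob : IsProbabilityMeasure Q := isProbabilityMeasure_tilted hexpβ
  have hQac : Q ≪ P := tilted_absolutelyContinuous P _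
  have hintTQ : ∀ T, Integrable (XT T) Q := by
    intro T
    refine integrable_tilted_of_exp_moments hexpβ hexp2β (hXm T) (half_pos hc₀) ?_
    rw [h2c]
    exact hexpT T c₀ hc₀.le le_rfl
  have hβXQ : Integrable (fun z => β * X z) Q := (hintTQ Finset.univ).const_mul β
  obtain ⟨hKLfin, hKLeq⟩ := klDiv_tilted_eq hexpβ hβXQ
  set KL : ℝ := (klDiv Q P).toReal with hKLdef
  have hKL0 : 0 ≤ KL := ENNReal.toReal_nonneg
  /- the half ledger -/
  have half : ∀ S : Finset (Fin (N + 1)), 2 * S.card ≤ N + 2 →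
      ∫ z, XT S z ∂Q ≤ (KL + (C₂ / τ + δ) * ((N : ℝ) + 1)) / κ + KL / α +
        α / 2 * ((KL + (C₃ / τ + δ) * ((N : ℝ) + 1)) / lam) := by
    intro S hS
    -- the group filtration, the forecast moment (K2) and the QV proxy (K3) at this `N`, `S`
    obtain ⟨ℱ, hmono, hle', hXae, h3N', V, hV0, hVm, hVsum, hVdom, hVexp⟩ := hN₀ N hN S hS
    have hXae' : AEStronglyMeasurable[⨆ n, ℱ n] (XT S) P := hXae
    have h3N : ∫⁻ z, ENNReal.ofReal (Real.exp (κ * (P[XT S|ℱ 0]) z)) ∂P ≤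
        ENNReal.ofReal (Real.exp ((C₂ / τ + δ) * ((N : ℝ) + 1))) := h3N'
    have hVm' : ∀ k, Measurable (V k) := fun k => (hVm k).mono (hle' k) le_rfl
    have hVsum' : ∀ᵐ z ∂P, Summable (fun k => V k z) := hVsum
    have hVdom' : ∀ (k : ℕ) (s : Set (Config (N + 1) (Fin 3) T3)), MeasurableSet[ℱ k] s →
        ∫⁻ z in s, ENNReal.ofReal (Real.exp (α * ((P[XT S|ℱ (k + 1)]) z - (P[XT S|ℱ k]) z) -
          α ^ 2 * V k z / 2)) ∂P ≤ P s := hVdom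
    have hVexp' : ∫⁻ z, ENNReal.ofReal (Real.exp (lam * ∑' k, V k z)) ∂P ≤
        ENNReal.ofReal (Real.exp ((C₃ / τ + δ) * ((N : ℝ) + 1))) := hVexp
    -- the initial forecast `f₀`
    have hf0P : Integrable (P[XT S|ℱ 0]) P := integrable_condExp
    have hf0m : AEStronglyMeasurable (P[XT S|ℱ 0]) P := hf0P.1
    have hf0expc : Integrable (fun z => Real.exp (c₀ * |(P[XT S|ℱ 0]) z|)) P := by
      have hp : Integrable (fun z => Real.exp (c₀ * XT S z)) P := by
        refine (hexpT S c₀ hc₀.le le_rfl).mono'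
          (Real.continuous_exp.comp_aestronglyMeasurable ((hXm S).const_mul c₀)) (ae_of_all _ fun z => ?_)
        rw [Real.norm_eq_abs, abs_of_pos (Real.exp_pos _)]
        exact Real.exp_le_exp.2 (mul_le_mul_of_nonneg_left (le_abs_self _) hc₀.le)
      have hn : Integrable (fun z => Real.exp (-c₀ * XT S z)) P := by
        refine (hexpT S c₀ hc₀.le le_rfl).mono'
          (Real.continuous_exp.comp_aestronglyMeasurable ((hXm S).const_mul (-c₀))) (ae_of_all _ fun z => ?_)
        rw [Real.norm_eq_abs, abs_of_pos (Real.exp_pos _)]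
        refine Real.exp_le_exp.2 ?_
        rw [neg_mul, ← mul_neg]
        exact mul_le_mul_of_nonneg_left (neg_le_abs _) hc₀.le
      have hp' := (integrable_exp_mul_condExp (hle' 0) (hintT S) c₀ hp).1
      have hn' := (integrable_exp_mul_condExp (hle' 0) (hintT S) (-c₀) hn).1
      refine (hp'.add hn').mono'
        ((by fun_prop : Continuous fun x : ℝ => Real.exp (c₀ * |x|)).comp_aestronglyMeasurable hf0m)
        (ae_of_all _ fun z => ?_)
      rw [Real.norm_eq_abs, abs_of_pos (Real.exp_pos _), Pi.add_apply]
      rcases le_or_gt 0 ((P[XT S|ℱ 0]) z) with h | h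
      · rw [abs_of_nonneg h]
        linarith [Real.exp_pos (-c₀ * (P[XT S|ℱ 0]) z)]
      · rw [abs_of_neg h, mul_neg, ← neg_mul]
        linarith [Real.exp_pos (c₀ * (P[XT S|ℱ 0]) z)]
    have hf0Q : Integrable (P[XT S|ℱ 0]) Q := by
      refine integrable_tilted_of_exp_moments hexpβ hexp2β hf0m (half_pos hc₀) ?_
      rw [h2c]
      exact hf0expc
    -- the proxy series `Σ V`
    have hVsm : AEStronglyMeasurable (fun z => ∑' k, V k z) P := aestronglyMeasurable_tsum hVm'
    obtain ⟨hVexpI, hVexpB⟩ := integrable_exp_of_lintegral_le (hVsm.const_mul lam) hVexp'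
    have hl2 : 2 * (lam / 2) = lam := by ring
    have hVQ : Integrable (fun z => ∑' k, V k z) Q := by
      refine integrable_tilted_of_exp_moments hexpβ hexp2β hVsm (half_pos hlam) ?_
      rw [hl2]
      refine hVexpI.congr (ae_of_all _ fun z => ?_)
      simp only []
      rw [abs_of_nonneg (tsum_nonneg fun k => hV0 k z)]
    -- the entropy ledger (S2)
    have hledger := hS2 (Config (N + 1) (Fin 3) T3) P Q hQac hKLfin ℱ hmono hle' (XT S) (hintT S)
      (hintTQ S) hXae' hf0Q α hα V hV0 hVm hVsum' hVQ hVdom'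
    -- the two entropy inequalities
    obtain ⟨hf0expκ, hf0B⟩ := integrable_exp_of_lintegral_le (hf0m.const_mul κ) h3N
    have hDVf : ∫ z, (P[XT S|ℱ 0]) z ∂Q ≤ (KL + (C₂ / τ + δ) * ((N : ℝ) + 1)) / κ :=
      integral_le_of_exp_moment hKLfin hf0Q hκ hf0expκ hf0B
    have hDVV : ∫ z, (∑' k, V k z) ∂Q ≤ (KL + (C₃ / τ + δ) * ((N : ℝ) + 1)) / lam :=
      integral_le_of_exp_moment hKLfin hVQ hlam hVexpI hVexpB
    have hfin : ∫ z, XT S z ∂Q ≤ ∫ z, (P[XT S|ℱ 0]) z ∂Q + KL / α + α / 2 * ∫ z, (∑' k, V k z) ∂Q := by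
      rw [hKLdef]; linarith
    linarith [mul_le_mul_of_nonneg_left hDVV (by positivity : (0 : ℝ) ≤ α / 2)]
  /- the two halves -/
  set m : ℕ := (N + 1) / 2 with hmdef
  have hmN : m < N + 1 := by omega
  set i₀ : Fin (N + 1) := ⟨m, hmN⟩ with hi₀
  set S₁ : Finset (Fin (N + 1)) := Finset.Iio i₀ with hS₁def
  have hcard₁ : S₁.card = m := by rw [hS₁def, Fin.card_Iio]
  set S₂ : Finset (Fin (N + 1)) := S₁ᶜ with hS₂def
  have hcard₂ : S₂.card = N + 1 - m := by rw [hS₂def, Finset.card_compl, Fintype.card_fin, hcard₁]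
  have hS₁ : 2 * S₁.card ≤ N + 2 := by rw [hcard₁]; omega
  have hS₂ : 2 * S₂.card ≤ N + 2 := by rw [hcard₂]; omega
  have hsplit : ∀ z, XT S₁ z + XT S₂ z = X z := fun z => Finset.sum_add_sum_compl S₁ _
  have hXQ : ∫ z, X z ∂Q = ∫ z, XT S₁ z ∂Q + ∫ z, XT S₂ z ∂Q := by
    rw [← integral_add (hintTQ S₁) (hintTQ S₂)]
    exact integral_congr_ae (ae_of_all _ fun z => (hsplit z).symm)
  have hhalf₁ := half S₁ hS₁
  have hhalf₂ := half S₂ hS₂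
  /- the ledger: `log ∫ e^{βX} dλ = β E_Q X − KL ≤ ε (N+1)` -/
  set B : ℝ := (Cp / τ + δ) * ((N : ℝ) + 1) with hBdef
  have hN1 : (0 : ℝ) ≤ (N : ℝ) + 1 := by positivity
  have hB₂ : (C₂ / τ + δ) * ((N : ℝ) + 1) ≤ B :=
    mul_le_mul_of_nonneg_right (add_le_add (div_le_div_of_nonneg_right hC₂le hτ0.le) le_rfl) hN1
  have hB₃ : (C₃ / τ + δ) * ((N : ℝ) + 1) ≤ B :=
    mul_le_mul_of_nonneg_right (add_le_add (div_le_div_of_nonneg_right hC₃le hτ0.le) le_rfl) hN1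
  set R : ℝ := (KL + B) / κ + KL / α + α / 2 * ((KL + B) / lam) with hRdef
  have hR₁ : ∫ z, XT S₁ z ∂Q ≤ R := by
    refine hhalf₁.trans (add_le_add (add_le_add ?_ le_rfl) ?_)
    · exact div_le_div_of_nonneg_right (by linarith) hκ.le
    · exact mul_le_mul_of_nonneg_left (div_le_div_of_nonneg_right (by linarith) hlam.le) (by positivity)
  have hR₂ : ∫ z, XT S₂ z ∂Q ≤ R := by
    refine hhalf₂.trans (add_le_add (add_le_add ?_ le_rfl) ?_)
    · exact div_le_div_of_nonneg_right (by linarith) hκ.le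
    · exact mul_le_mul_of_nonneg_left (div_le_div_of_nonneg_right (by linarith) hlam.le) (by positivity)
  have hRid : 2 * β * R - KL =
      KL * (2 * β * (1 / κ + 1 / α + α / (2 * lam)) - 1) + 2 * β * D * (Cp / τ + δ) * ((N : ℝ) + 1) := by
    rw [hRdef, hBdef, hDdef]
    field_simp
    ring
  have hneg : KL * (2 * β * (1 / κ + 1 / α + α / (2 * lam)) - 1) ≤ 0 := by
    have h := mul_le_mul_of_nonneg_left hβ1 hKL0
    linarith
  have hlog : Real.log (∫ z, Real.exp (β * X z) ∂P) ≤ ε * ((N : ℝ) + 1) := by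
    have hI : ∫ z, β * X z ∂Q = β * ∫ z, X z ∂Q := integral_const_mul _ _
    have hZ : Real.log (∫ z, Real.exp (β * X z) ∂P) = β * ∫ z, X z ∂Q - KL := by
      rw [hKLeq, hI]; ring
    rw [hZ, hXQ]
    have h1 : β * (∫ z, XT S₁ z ∂Q + ∫ z, XT S₂ z ∂Q) ≤ 2 * β * R := by
      have h := mul_le_mul_of_nonneg_left (add_le_add hR₁ hR₂) hβ.le
      linarith
    have h2 : 2 * β * D * (Cp / τ + δ) * ((N : ℝ) + 1) ≤ ε * ((N : ℝ) + 1) :=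
      mul_le_mul_of_nonneg_right hbudget hN1
    linarith [hRid, hneg, h1, h2]
  /- conversion to the `∫⁻` form -/
  have hZpos : 0 < ∫ z, Real.exp (β * X z) ∂P := integral_exp_pos hexpβ
  have hgoal : ∫⁻ z, ENNReal.ofReal (Real.exp (β * X z)) ∂P ≤ ENNReal.ofReal (Real.exp (ε * ((N : ℝ) + 1))) := by
    rw [← ofReal_integral_eq_lintegral_ofReal hexpβ (ae_of_all _ fun _ => (Real.exp_pos _).le)]
    refine ENNReal.ofReal_le_ofReal ?_
    rw [← Real.exp_log hZpos]
    exact Real.exp_le_exp.2 hlog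
  exact hgoal

end Summit.AtomisticToContinuum.HydrodynamicLimit.Theorems.KineticCurrentsWindowLDUniformGossip

end
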